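import Mathlib
import Summits.Ventures.PercRepro2.SwOutCrossJunctionQSwGN
import Summits.Ventures.PercRepro2.SwOutCrossJunctionAny

/-!
# THEOREM A_cross WITH THE MARK AT A DROPPED VERTEX FOR ANY CROSS GRAPH (blind cell PercRepro2,
night-4 g27, 2026-08-28; proofs/NIGHT4-G27.md §4)

A cross junction with the mark at a dropped vertex is re-indexed along a graph isomorphism of its
cross graph, the mark following (`CrossJunctionQ.reindex`), and every finite graph is isomorphic
to the nested disjoint union of its connected components enumerated with THE COMPONENT OF A
GIVEN VERTEX LAST — i.e. at the base of g25's `sumX` — that vertex being a base vertex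
(`exists_sumG_iso_mark`: the enumeration `(univ.erase D).toList ++ [D]` of g25's `sumGIso`, the
base read through `baseVal` / `baseElem`).  Hence **`sw_of_crossJunctionQ_any`**: row (SW) on
every graph with a junction whose neighbours are `h`-adjacent or dropped vertices forming ANY
simple cross-edge graph, the mark being one of the dropped vertices — the last boundary of
NIGHT4-G25.md §7′ item 3(b) at the class level (one junction, simple cross edges, no pieces).
-/

namespace Summit.Ventures.PercRepro2

namespace CrossArm

open Hull LocRows

universe u uV

section Reindex

variable {V : Type uV} {E : Type*} {ends : E → Sym2 V} {X X' : Type*} {U : Set V} {h o u : V}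
  {p : X → V} {G : SimpleGraph X} {G' : SimpleGraph X'} {r : X}

/-- **A cross junction with the mark at a dropped vertex, re-indexed along a graph isomorphism of
its cross graph** (the mark follows). -/
theorem CrossJunctionQ.reindex (hj : CrossJunctionQ ends U h u p G o r) (φ : G' ≃g G) :
    CrossJunctionQ ends U h u (p ∘ φ) G' o (φ.symm r) where
  hne_hu := hj.hne_hu
  hne_hp := fun i => hj.hne_hp (φ i)
  hne_up := fun i => hj.hne_up (φ i)
  p_inj := hj.p_inj.comp φ.injective
  hqr := by
    show o = p (φ (φ.symm r))
    rw [RelIso.apply_symm_apply]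
    exact hj.hqr
  hext_r := by
    obtain ⟨e, y, hey, hyU, hyu, hyp⟩ := hj.hext_r
    refine ⟨e, y, ?_, hyU, hyu, fun j => hyp (φ j)⟩
    show ends e = s(p (φ (φ.symm r)), y)
    rw [RelIso.apply_symm_apply]
    exact hey
  hhU := hj.hhU
  huU := hj.huU
  hpU := fun i => hj.hpU (φ i)
  hloop_h := hj.hloop_h
  hloop_u := hj.hloop_u
  hnadj := hj.hnadj
  hnadj_p := fun i => hj.hnadj_p (φ i)
  hup := fun i => hj.hup (φ i)
  hcross := fun i j hij => hj.hcross (φ i) (φ j) (φ.map_adj_iff.2 hij)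
  hcross_adj := fun i j e he => φ.map_adj_iff.1 (hj.hcross_adj (φ i) (φ j) e he)
  hcross_simple := fun i j e e' he he' => hj.hcross_simple (φ i) (φ j) e e' he he'
  hu_adj_h := fun e x he hx => hj.hu_adj_h e x he fun i hi => hx (φ.symm i) (by
    show x = p (φ (φ.symm i))
    rw [RelIso.apply_symm_apply]
    exact hi)
  hp_in := fun i e x he hxU => by
    rcases hj.hp_in (φ i) e x he hxU with h' | ⟨j, hj'⟩
    · exact Or.inl h'
    · refine Or.inr ⟨φ.symm j, ?_⟩
      show x = p (φ (φ.symm j))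
      rw [RelIso.apply_symm_apply]
      exact hj'
  hout := hj.hout

end Reindex

section Lists

variable {α : Type*}

/-- The last element of a non-empty list, given head first. -/
def lastOf : α → List α → α
  | a, [] => a
  | _, b :: l => lastOf b l

/-- The base component of a mapped list is the image of its last element. -/
lemma baseC_map (f : α → CompG.{u}) : ∀ (C : α) (l : List α),
    baseC (f C) (l.map f) = f (lastOf C l)
  | _, [] => rfl
  | _, D :: l => baseC_map f D l

/-- The last element of a list ending in `D` is `D`. -/
lemma lastOf_append_singleton (D : α) : ∀ (a : α) (l : List α), lastOf a (l ++ [D]) = D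
  | _, [] => rfl
  | _, b :: l => lastOf_append_singleton D b l

/-- A list ending in `D`, written head first, has last element `D`. -/
lemma lastOf_of_append_singleton : ∀ (l' : List α) (D C : α) (l : List α),
    l' ++ [D] = C :: l → lastOf C l = D
  | [], D, C, l, h => by
    simp only [List.nil_append, List.cons.injEq] at h
    obtain ⟨rfl, rfl⟩ := h
    rfl
  | a :: l', D, C, l, h => by
    simp only [List.cons_append, List.cons.injEq] at h
    obtain ⟨rfl, rfl⟩ := h
    exact lastOf_append_singleton D a l'

end Lists

section Components

variable {X : Type u} (G : SimpleGraph X) [Fintype X] [DecidableEq X] [DecidableRel G.Adj]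

open Classical

/-- The vertex of `G` carried by a vertex of the base component. -/
noncomputable def baseVal : ∀ (C : G.ConnectedComponent) (l : List G.ConnectedComponent),
    (baseC (compOf G C) (l.map (compOf G))).X → X
  | _, [], x => x.1
  | _, D :: l, x => baseVal D l x

/-- `toX` of a base vertex is the vertex it carries. -/
lemma toX_baseIn : ∀ (C : G.ConnectedComponent) (l : List G.ConnectedComponent)
    (x : (baseC (compOf G C) (l.map (compOf G))).X),
    toX G C l (baseIn (compOf G C) (l.map (compOf G)) x) = baseVal G C l x
  | _, [], _ => rfl
  | _, D :: l, x => toX_baseIn D l x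

/-- A vertex of `G` lying in the component of the last element, as a vertex of the base
component. -/
noncomputable def baseElem : ∀ (C : G.ConnectedComponent) (l : List G.ConnectedComponent) (r : X),
    G.connectedComponentMk r = lastOf C l → (baseC (compOf G C) (l.map (compOf G))).X
  | _, [], r, hr => ⟨r, hr⟩
  | _, D :: l, r, hr => baseElem D l r hr

/-- `baseElem` carries the given vertex. -/
lemma baseVal_baseElem : ∀ (C : G.ConnectedComponent) (l : List G.ConnectedComponent) (r : X)
    (hr : G.connectedComponentMk r = lastOf C l), baseVal G C l (baseElem G C l r hr) = r
  | _, [], _, _ => rfl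
  | _, D :: l, r, hr => baseVal_baseElem D l r hr

/-- **Every finite graph is the nested sum of its components with the component of a given
vertex at the base**, that vertex being a base vertex. -/
theorem exists_sumG_iso_mark (r : X) :
    ∃ (C : G.ConnectedComponent) (l : List G.ConnectedComponent)
      (φ : sumG (compOf G C) (l.map (compOf G)) ≃g G)
      (q : (baseC (compOf G C) (l.map (compOf G))).X),
      φ (baseIn (compOf G C) (l.map (compOf G)) q) = r := by
  obtain ⟨C, l, hl⟩ : ∃ C l, ((Finset.univ : Finset G.ConnectedComponent).erase
      (G.connectedComponentMk r)).toList ++ [G.connectedComponentMk r] = C :: l := by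
    rcases h : ((Finset.univ : Finset G.ConnectedComponent).erase
        (G.connectedComponentMk r)).toList ++ [G.connectedComponentMk r] with _ | ⟨C, l⟩
    · exact absurd h (by simp)
    · exact ⟨C, l, rfl⟩
  have hnd : (C :: l).Nodup := by
    rw [← hl]
    refine List.nodup_append.2 ⟨Finset.nodup_toList _, List.nodup_singleton _, ?_⟩
    intro x hx y hy hxy
    rw [List.mem_singleton] at hy
    rw [hxy, hy, Finset.mem_toList] at hx
    exact Finset.notMem_erase _ _ hx
  have hall : ∀ D, D ∈ C :: l := by
    intro D
    rw [← hl, List.mem_append, List.mem_singleton, Finset.mem_toList, Finset.mem_erase]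
    by_cases hD : D = G.connectedComponentMk r
    · exact Or.inr hD
    · exact Or.inl ⟨hD, Finset.mem_univ _⟩
  have hlast : G.connectedComponentMk r = lastOf C l :=
    (lastOf_of_append_singleton _ _ C l hl).symm
  refine ⟨C, l, sumGIso G C l hnd hall, baseElem G C l r hlast, ?_⟩
  show toX G C l (baseIn (compOf G C) (l.map (compOf G)) (baseElem G C l r hlast)) = r
  rw [toX_baseIn, baseVal_baseElem]

end Components

section Any

variable {V : Type uV} {E : Type*} [Fintype E] [DecidableEq E]

open scoped Classical

variable {ends : E → Sym2 V} {X : Type u} [Fintype X] [DecidableEq X] {G : SimpleGraph X}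
  [DecidableRel G.Adj] {U : Set V} {l h o u : V} {p : X → V} {r : X}

/-- **THEOREM A_cross WITH THE MARK AT A DROPPED VERTEX FOR ANY CROSS GRAPH: the rigid
inequality on every class of a junction whose dropped vertices form any simple cross-edge graph
and whose mark is one of them**, for every outside colouring. -/
theorem CrossJunctionQ.rigidOK_of_crossJunctionQ_any (hj : CrossJunctionQ ends U h u p G o r)
    (hl : l ∉ U) (ξ : Config E) : RigidOK ends l h o U ξ := by
  obtain ⟨C, l', φ, q, hq⟩ := exists_sumG_iso_mark G r
  have hj' := hj.reindex φ
  have hr : φ.symm r = baseIn (compOf G C) (l'.map (compOf G)) q := by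
    rw [← hq, RelIso.symm_apply_apply]
  rw [hr] at hj'
  exact hj'.rigidOK_of_crossJunctionQN (compOf G C) (l'.map (compOf G)) q hl ξ

/-- **Row 2′SW-ALL on every graph with a junction whose dropped vertices form any simple
cross-edge graph and whose mark is one of them.** -/
theorem swAll_of_crossJunctionQ_any (hlh : l ≠ h) (hj : CrossJunctionQ ends ({l}ᶜ) h u p G o r) :
    SwAll ends l h o :=
  swAll_of_reducible l h o hlh (Reducible.base ends _ fun ξ =>
    hj.rigidOK_of_crossJunctionQ_any (by simp) ξ)

/-- **Row (SW) on every graph with a junction whose dropped vertices form any simple cross-edge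
graph and whose mark is one of them** — Theorem A_cross with the mark at a dropped vertex, in
full at the class level (one junction, simple cross edges, no pieces). -/
theorem sw_of_crossJunctionQ_any (hlh : l ≠ h) (hj : CrossJunctionQ ends ({l}ᶜ) h u p G o r) :
    Sw ends l h o :=
  sw_of_swAll ends (swAll_of_crossJunctionQ_any hlh hj)

end Any

end CrossArm

end Summit.Ventures.PercRepro2
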